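import Summits.NavierStokesRegularity.NavierStokesRegularity.Theorems.CertifiedBlowupCertifiedBlowupVorticityRateBlowupInnerObject
import Literature.Analysis.FluidPDE.KNSSPoloidalAxisDecay
import Literature.Analysis.FluidPDE.KNSSBlowupLimitClassical
import Summits.NavierStokesRegularity.OSWSelfSimilar.AxisymAngularVelocityHalfVorticity
import Summits.NavierStokesRegularity.OSWSelfSimilar.AxisymSwirlVelocityTypeI
import HarnessLib

/-!
# A witness of the certificate class `CertifiedBlowupVorticityRateBlowup` (stmt-NavierStokesRegularity-8639):
# VORTICITY TYPE I ⇒ ANGULAR-VELOCITY TYPE I, and the inner object's swirl funnel `|s|·|Γ_W(s, y)| ≤ ½ C_ω r(y)²`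

Theorems file landed `--supports stmt-NavierStokesRegularity-8639` (cell `ns-blowup`, GROUP B zone Z1 → the certificate
crux of route CertifiedBlowup), continuing `…CertifiedBlowupVorticityRateBlowupInnerObject` (the inner object's vorticity
decays like `C_ω/|s|`; Type I along the gauge times in the swirling branch). A witness of the certificate class is a witness
`(ν, T, u, p)` of `CertifiedBlowupAxisymBlowup` obeying the dynamic-rescaling rate `(T − t)‖ω(t)‖_∞ ≤ C_ω` as `t ↑ T`.
Integrating Majda–Bertozzi's (2.64) along horizontal rays (zone-Z1 dictionary part XL,
`Summit.NavierStokesRegularity.OSWSelfSimilar.TypeIIModulationDictionary.abs_angVelQuot_le_of_norm_curl_le`: the angular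
velocity of an axisymmetric flow is at most half its maximal vorticity, sharp on the rigid rotation) gives:

* `vorticityRate_witness_swirl_funnel` — for `t` near `T⁻` and all `x`: `(T − t)|Γ(t, x)| ≤ ½ C_ω r(x)²` (the swirl of the
  witness is at most quadratic at the parabolic scale `r ~ √(T − t)`);
* `vorticityRate_witness_angVelQuot_typeI` — **vorticity Type I ⇒ angular-velocity Type I**: `(T − t)|(u_θ/r)(t, x)| ≤ ½ C_ω`
  for `t` near `T⁻` and all `x` (Hou's variable `u₁ = u_θ/r`; the zone-Z1 swirl gauge N-b `λ_b = u₁(centre)^{−1/2}` of such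
  a witness is Type-I-slow, `λ_b(t)² ≥ 2(T − t)/C_ω`);
* `innerObject_swirl_funnel_of_curl_le` — for ANY KNSS blow-up limit `W` with axisymmetric slices and
  `‖curl W(s)‖_∞ ≤ C/|s|`: `|s|·|Γ_W(s, y)| ≤ ½ C r(y)²` and `|s|·|(W_θ/r)(s, y)| ≤ ½ C` for all `s < 0`, `y` — the inner
  object is **asymptotically swirl-free into the past** on every region `r = o(√|s|)`, its angular velocity decays at the
  Type-I rate `C/(2|s|)`;
* `vorticityRate_witness_innerObject_funnel_alternative` — the assembled statement for every witness of the certificate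
  class: the Z1 gauge data and inner object `W` with `‖curl W(s)‖ ≤ C_ω/|s|`, and EITHER (α) `W ≡ c` (velocity-dominated
  core) OR (β) `W` is axisymmetric with `¬AxisymmetricLiouvilleBoundedSwirl`, carries swirl (`Γ_W ≢ 0`, escaping to
  `r → ∞` at some level `ε > 0`), AND obeys the past funnel `|s|·|Γ_W(s, y)| ≤ ½ C_ω r(y)²`, `|s|·|(W_θ/r)(s, y)| ≤ ½ C_ω`
  — so in branch (β) the level-`ε` swirl of the inner object sits at radii `r ≥ √(2ε|s|/C_ω)` at every past time `s`.

* APPENDIX (second deposit, part XLI `u_θ² ≤ ½‖Γ‖_∞‖ω‖_∞`): `vorticityRate_witness_sq_swirlVelocity_typeI` — **the swirl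
  VELOCITY of a certificate-class witness is TYPE I**, `(T − t)u_θ² ≤ ½MₛC_ω`; `vorticityRate_witness_not_poloidal_typeI` —
  **the blow-up is POLOIDAL and Type II** (no `C'` with `‖u_pol‖ ≤ C'/√(T − t)` near `T⁻`, by KNSS's Type-I exclusion);
  `innerObject_sq_swirlVelocity_le_of_curl_le` — in branch (β) `|s|·W_θ(s, y)² ≤ ½(Mₛ/ν)C_ω`, the inner object's swirl
  velocity dies UNIFORMLY into the past; `vorticityRate_witness_poloidal_alternative` — assembled.

* APPENDIX 2 (third deposit; KNSS (1.9)–(1.10) swirl maximum principle for the blow-up limit, Literature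
  `IsKNSSBlowupLimit.abs_swirl_le_of_le`): `innerObject_swirl_import` — **SWIRL IMPORT FROM INFINITY** (a level `m < |Γ_W(s₀,y₀)|`
  is present at every `s ≤ s₀`, only at radii `r > √(2m|s|/C_ω)`); `vorticityRate_witness_swirlImport_alternative` — assembled.

WHY NO REGULARITY WORD FOLLOWS: `(T − t)‖u_θ/r‖_∞ ≤ C_ω/2` is the weak-`L¹`-in-time endpoint of the printed angular-velocity
criteria (strong time-integrability / smallness at the axis uniformly in `t` is what they need); the funnel is a
CONSTRAINT on certificate-class profiles, not a contradiction. No new definitions, no named-fact hypotheses, no `sorry`.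
WHAT THIS IS NOT: not a blow-up or regularity claim and no word on (AX-L) — implications about a HYPOTHETICAL
certificate-class witness. Author: ns-blowup-profile-eng-1 g10, 2026-08-27.

## References
* A. J. Majda, A. L. Bertozzi, *Vorticity and Incompressible Flow*, CUP 2002, §2.3.3 eq. (2.64). [MajdaBertozziCUP2002]
* G. Koch, N. Nadirashvili, G. Seregin, V. Šverák, Acta Math. 203 (2009), §6. [KochNadirashviliSereginSverak2009]
* T. Y. Hou, Found. Comput. Math. 23 (2022) = arXiv:2107.06509 (dynamic rescaling; the variable `u₁ = u_θ/r`).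
  [Hou2022PotentiallySingularNS]
-/

-- the summit and its single problem share the name (D-0017 nested layout)
set_option linter.dupNamespace false

open MeasureTheory Set Function Filter Topology Metric
open scoped ENNReal NNReal

namespace Summit.NavierStokesRegularity.NavierStokesRegularity.Theorems.CertifiedBlowupVorticityRateBlowup.InnerObject

open Literature.Analysis.FluidPDE
open Summit.NavierStokesRegularity.OSWSelfSimilar.TypeIIModulationDictionary
open Summit.NavierStokesRegularity.NavierStokesRegularity.Theorems.CertifiedBlowupAxisymBlowup.CompactAmplification

/-! ### The witness: vorticity Type I ⇒ angular-velocity Type I -/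

section Witness

variable {ν T C : ℝ} {u : ℝ → EuclideanSpace ℝ (Fin 3) → EuclideanSpace ℝ (Fin 3)}
  {p : ℝ → EuclideanSpace ℝ (Fin 3) → ℝ}

/-- Near `T⁻` the slices of a witness are axisymmetric and `C²` (classical solution on `[0, T)`; axisymmetry of the slices
from the datum by weak–strong uniqueness, `isAxisymmetric_slice_of_lerayHopf_classical`). [folklore] -/
theorem eventually_isAxisymmetric_and_contDiff_slice (hν : 0 < ν) (hT : 0 < T) (hmax : IsMaximalSmoothSolution ν 0 u p T)
    (hLH : IsLerayHopfOn T ν 0 (u 0) u) (hdec : HasRapidSpatialDecay (u 0)) (haxi : IsAxisymmetric (u 0)) :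
    (∀ᶠ t in 𝓝[<] T, IsAxisymmetric (u t)) ∧ ∀ᶠ t in 𝓝[<] T, ContDiff ℝ 2 (u t) := by
  have hcl := hmax.isClassicalNSSolutionOn
  have hIco : ∀ᶠ t in 𝓝[<] T, t ∈ Ico 0 T := Ico_mem_nhdsLT hT
  exact ⟨hIco.mono fun t ht => isAxisymmetric_slice_of_lerayHopf_classical hν hcl hLH hdec haxi t ht,
    hIco.mono fun t ht => contDiff_infty.1 (hcl.contDiff_velocity ht) 2⟩

/-- **The swirl funnel of a certificate-class witness**: if `(T − t)‖ω(t, x)‖ ≤ C_ω` for `t` near `T⁻`, then for `t` near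
`T⁻` and every `x`, `(T − t)|Γ(t, x)| ≤ ½ C_ω r(x)²` (`Γ = swirl (u t) = r u_θ`): the swirl is at most quadratic in `r` at the
parabolic scale. [cite: MajdaBertozziCUP2002, §2.3.3 eq. (2.64) (integrated along horizontal rays)] -/
theorem vorticityRate_witness_swirl_funnel (hν : 0 < ν) (hT : 0 < T) (hmax : IsMaximalSmoothSolution ν 0 u p T)
    (hLH : IsLerayHopfOn T ν 0 (u 0) u) (hdec : HasRapidSpatialDecay (u 0)) (haxi : IsAxisymmetric (u 0))
    (hrate : ∀ᶠ t in 𝓝[<] T, ∀ x, (T - t) * ‖curl (u t) x‖ ≤ C) :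
    ∀ᶠ t in 𝓝[<] T, ∀ x, (T - t) * |swirl (u t) x| ≤ C / 2 * cylRadius x ^ 2 := by
  obtain ⟨hax, hu⟩ := eventually_isAxisymmetric_and_contDiff_slice hν hT hmax hLH hdec haxi
  exact eventually_abs_swirl_le_of_vorticityRate hax (hu.mono fun t ht => ht.differentiable two_ne_zero) hrate

/-- **VORTICITY TYPE I ⇒ ANGULAR-VELOCITY TYPE I for a certificate-class witness** (sharp constant `½`): if
`(T − t)‖ω(t, x)‖ ≤ C_ω` for `t` near `T⁻`, then `(T − t)|(u_θ/r)(t, x)| ≤ ½ C_ω` for `t` near `T⁻` and every `x`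
(`u_θ/r = angVelQuot (u t)`, Hou's `u₁`). Hence the zone-Z1 swirl gauge `λ_b(t) = |u₁(x_c(t), t)|^{−1/2}` of such a witness
obeys `λ_b(t)² ≥ 2(T − t)/C_ω`. [cite: MajdaBertozziCUP2002, §2.3.3 eq. (2.64) (integrated along horizontal rays)] -/
theorem vorticityRate_witness_angVelQuot_typeI (hν : 0 < ν) (hT : 0 < T) (hmax : IsMaximalSmoothSolution ν 0 u p T)
    (hLH : IsLerayHopfOn T ν 0 (u 0) u) (hdec : HasRapidSpatialDecay (u 0)) (haxi : IsAxisymmetric (u 0))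
    (hrate : ∀ᶠ t in 𝓝[<] T, ∀ x, (T - t) * ‖curl (u t) x‖ ≤ C) :
    ∀ᶠ t in 𝓝[<] T, ∀ x, (T - t) * |angVelQuot (u t) x| ≤ C / 2 := by
  obtain ⟨hax, hu⟩ := eventually_isAxisymmetric_and_contDiff_slice hν hT hmax hLH hdec haxi
  exact eventually_abs_angVelQuot_le_of_vorticityRate hax hu hrate

end Witness

/-! ### The inner object: the past swirl funnel -/

section Inner

variable {C : ℝ} {W : ℝ → EuclideanSpace ℝ (Fin 3) → EuclideanSpace ℝ (Fin 3)}

/-- **The past swirl funnel of an axisymmetric KNSS blow-up limit with vorticity `≤ C/|s|`.** For a KNSS blow-up limit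
`W` (smooth on `(−∞, 0) × ℝ³`) whose slices are axisymmetric and satisfy `‖curl W(s)(y)‖ ≤ C/|s|` (`s < 0`): for every
`s < 0` and `y`, `|s|·|Γ_W(s, y)| ≤ ½ C r(y)²` and `|s|·|(W_θ/r)(s, y)| ≤ ½ C` — the limit is asymptotically swirl-free
into the past on `r = o(√|s|)`, with angular velocity decaying at the Type-I rate.
[cite: MajdaBertozziCUP2002, §2.3.3 eq. (2.64) (integrated along horizontal rays)] -/
theorem innerObject_swirl_funnel_of_curl_le (hW : IsKNSSBlowupLimit W) (hax : ∀ s < 0, IsAxisymmetric (W s))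
    (hcurl : ∀ s < 0, ∀ y : EuclideanSpace ℝ (Fin 3), ‖curl (W s) y‖ ≤ C / |s|) {s : ℝ} (hs : s < 0)
    (y : EuclideanSpace ℝ (Fin 3)) :
    |s| * |swirl (W s) y| ≤ C / 2 * cylRadius y ^ 2 ∧ |s| * |angVelQuot (W s) y| ≤ C / 2 := by
  have hsm : ContDiff ℝ 2 (W s) :=
    contDiff_infty.1 (hW.smooth.comp_contDiff (contDiff_prodMk_right s) fun y => ⟨hs, mem_univ y⟩) 2
  have hs' : 0 < |s| := abs_pos.2 hs.ne
  have h1 := abs_swirl_le_of_norm_curl_le (hax s hs) (hsm.differentiable two_ne_zero) (hcurl s hs) y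
  have h2 := abs_angVelQuot_le_of_norm_curl_le (hax s hs) hsm (hcurl s hs) y
  constructor
  · calc |s| * |swirl (W s) y| ≤ |s| * (C / |s| / 2 * cylRadius y ^ 2) := mul_le_mul_of_nonneg_left h1 hs'.le
      _ = C / 2 * cylRadius y ^ 2 := by field_simp
  · calc |s| * |angVelQuot (W s) y| ≤ |s| * (C / |s| / 2) := mul_le_mul_of_nonneg_left h2 hs'.le
      _ = C / 2 := by field_simp

/-- **Where the inner object's swirl can live**: under the hypotheses of `innerObject_swirl_funnel_of_curl_le` with
`0 < C`, a value `ε < |Γ_W(s, y)|` at a past time `s < 0` forces `2ε|s|/C < r(y)²` — the level-`ε` swirl sits outside the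
parabolic radius `√(2ε|s|/C)`. [cite: MajdaBertozziCUP2002, §2.3.3 eq. (2.64) (integrated along horizontal rays)] -/
theorem innerObject_cylRadius_sq_gt_of_lt_abs_swirl (hW : IsKNSSBlowupLimit W) (hax : ∀ s < 0, IsAxisymmetric (W s))
    (hcurl : ∀ s < 0, ∀ y : EuclideanSpace ℝ (Fin 3), ‖curl (W s) y‖ ≤ C / |s|) (hC : 0 < C) {s : ℝ} (hs : s < 0)
    {y : EuclideanSpace ℝ (Fin 3)} {ε : ℝ} (hε : ε < |swirl (W s) y|) :
    2 * ε * |s| / C < cylRadius y ^ 2 := by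
  have h := (innerObject_swirl_funnel_of_curl_le hW hax hcurl hs y).1
  have hs' : 0 < |s| := abs_pos.2 hs.ne
  rw [div_lt_iff₀ hC]
  nlinarith [mul_lt_mul_of_pos_left hε hs']

end Inner

/-! ### The assembled statement for a witness of the certificate class -/

section Assembled

variable {ν T : ℝ} {u : ℝ → EuclideanSpace ℝ (Fin 3) → EuclideanSpace ℝ (Fin 3)}
  {p : ℝ → EuclideanSpace ℝ (Fin 3) → ℝ}

/-- **CERTIFICATE-CLASS WITNESSES: THE ANGULAR-VELOCITY TYPE-I BOUND AND THE INNER OBJECT'S PAST SWIRL FUNNEL.** For every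
`(ν, T, u, p)` with `IsMaximalSmoothSolution ν 0 u p T`, `0 < ν`, `0 < T`, Leray–Hopf, rapidly decaying axisymmetric datum, and
the rate `(T − t)‖ω(t, ·)‖_∞ ≤ C_ω` near `T⁻`: (i) `(T − t)|u_θ/r| ≤ ½C_ω` and `(T − t)|Γ| ≤ ½C_ω r²` near `T⁻`; (ii) the zone-Z1
gauge N-a data and inner object `W` (`tₖ → T`, `λₖ → 0`, `(λₖ/ν)‖u‖ ≤ 1` on `[0, tₖ]`, zoom `→ W` a KNSS blow-up limit) with
`‖curl W(s)(y)‖ ≤ C_ω/|s|`, and EITHER (α) `W ≡ c`, `‖c‖ = 1`, `c₁ = 0`, OR (β) centres on the axis, `W` axisymmetric slice by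
slice, `¬AxisymmetricLiouvilleBoundedSwirl`, `|Γ_W| ≤ Mₛ/ν`, `Γ_W ≢ 0`, the swirl escapes to `r → ∞` at a level `ε > 0`,
AND THE PAST FUNNEL `|s|·|Γ_W(s, y)| ≤ ½C_ω r(y)²`, `|s|·|(W_θ/r)(s, y)| ≤ ½C_ω` for all `s < 0`, `y`.
[cite: KochNadirashviliSereginSverak2009, §6 (zoom bookkeeping)] -/
theorem vorticityRate_witness_innerObject_funnel_alternative (hν : 0 < ν) (hT : 0 < T)
    (hmax : IsMaximalSmoothSolution ν 0 u p T) (hLH : IsLerayHopfOn T ν 0 (u 0) u)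
    (hdec : HasRapidSpatialDecay (u 0)) (haxi : IsAxisymmetric (u 0))
    (hrate : ∃ C : ℝ, ∀ᶠ t in 𝓝[<] T, ∀ x : EuclideanSpace ℝ (Fin 3), (T - t) * ‖curl (u t) x‖ ≤ C) :
    ∃ (C Mₛ : ℝ) (tn lamn : ℕ → ℝ) (cn : ℕ → EuclideanSpace ℝ (Fin 3)) (φ : ℕ → ℕ)
      (W : ℝ → EuclideanSpace ℝ (Fin 3) → EuclideanSpace ℝ (Fin 3)),
      (∀ᶠ t in 𝓝[<] T, ∀ x, (T - t) * |angVelQuot (u t) x| ≤ C / 2) ∧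
      (∀ᶠ t in 𝓝[<] T, ∀ x, (T - t) * |swirl (u t) x| ≤ C / 2 * cylRadius x ^ 2) ∧
      (∀ k, T / 2 ≤ tn k ∧ tn k < T) ∧ Tendsto tn atTop (𝓝 T) ∧ (∀ k, 0 < lamn k) ∧ Tendsto lamn atTop (𝓝 0) ∧
      (∀ k, ∀ t ∈ Icc 0 (tn k), ∀ x, lamn k / ν * ‖u t x‖ ≤ 1) ∧ StrictMono φ ∧ IsKNSSBlowupLimit W ∧
      (∀ s < 0, TendstoLocallyUniformly
        (fun k => ((lamn (φ k) / ν) • stPull (lamn (φ k) ^ 2 / ν) (lamn (φ k)) (tn (φ k)) (cn (φ k)) u) s)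
          (W s) atTop) ∧
      (∀ s < 0, ∀ y : EuclideanSpace ℝ (Fin 3), ‖curl (W s) y‖ ≤ C / |s|) ∧
      ((∃ c : EuclideanSpace ℝ (Fin 3), ‖c‖ = 1 ∧ c 1 = 0 ∧ ∀ s < 0, ∀ y : EuclideanSpace ℝ (Fin 3), W s y = c) ∨
        ((∀ k, cn k 0 = 0 ∧ cn k 1 = 0) ∧
          ¬ Summit.NavierStokesRegularity.NavierStokesRegularity.AxisymmetricLiouvilleBoundedSwirl ∧
          (∀ s < 0, IsAxisymmetric (W s)) ∧ (∀ s < 0, ∀ y : EuclideanSpace ℝ (Fin 3), |swirl (W s) y| ≤ Mₛ / ν) ∧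
          (∃ s < 0, ∃ y : EuclideanSpace ℝ (Fin 3), swirl (W s) y ≠ 0) ∧
          (∃ ε : ℝ, 0 < ε ∧ ∀ R : ℝ, ∃ s < 0, ∃ x : EuclideanSpace ℝ (Fin 3),
            R ≤ cylRadius x ∧ ε < |swirl (W s) x|) ∧
          (∀ s < 0, ∀ y : EuclideanSpace ℝ (Fin 3), |s| * |swirl (W s) y| ≤ C / 2 * cylRadius y ^ 2) ∧
          ∀ s < 0, ∀ y : EuclideanSpace ℝ (Fin 3), |s| * |angVelQuot (W s) y| ≤ C / 2)) := by
  obtain ⟨C, hC⟩ := hrate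
  obtain ⟨Mₛ, hMₛ⟩ := hdec.abs_swirl_le
  obtain ⟨tn, lamn, cn, xn, φ, W, htn, htT, hlam, hlam0, hgauge, -, -, -, -, -, -, hφ, hW, hconv, -, hcurl, halt⟩ :=
    innerObject_master_of_datum hν hT hmax hLH hdec haxi hMₛ
  have hcurlle : ∀ s < 0, ∀ y : EuclideanSpace ℝ (Fin 3), ‖curl (W s) y‖ ≤ C / |s| :=
    fun s hs y => vorticityRate_innerObject_curl_le hν htn htT hlam0 hφ hC hcurl hs y
  refine ⟨C, Mₛ, tn, lamn, cn, φ, W, vorticityRate_witness_angVelQuot_typeI hν hT hmax hLH hdec haxi hC,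
    vorticityRate_witness_swirl_funnel hν hT hmax hLH hdec haxi hC, htn, htT, hlam, hlam0, hgauge, hφ, hW, hconv,
    hcurlle, ?_⟩
  rcases halt with ⟨hc, -⟩ | ⟨hax0, hnot, haxW, hswb, -, -, hswirl, -, -, -, hesc, -⟩
  · exact Or.inl hc
  · refine Or.inr ⟨hax0, hnot, haxW, hswb, ?_, hesc, fun s hs y => (innerObject_swirl_funnel_of_curl_le hW haxW hcurlle hs y).1,
      fun s hs y => (innerObject_swirl_funnel_of_curl_le hW haxW hcurlle hs y).2⟩
    obtain ⟨s, hs, y, hne, -⟩ := hswirl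
    exact ⟨s, hs, y, hne⟩

end Assembled


/-! ### Appendix (g10, second deposit): the swirl velocity of a certificate-class witness is TYPE I and the Type-II excess is
POLOIDAL (zone-Z1 dictionary part XLI `sq_swirlVelocity_le_of_abs_swirl_le_of_norm_curl_le`: `u_θ² ≤ ½‖Γ‖_∞‖ω‖_∞`, a
SCALE-INVARIANT product); the inner object's swirl VELOCITY dies uniformly into the past in branch (β). -/

section Poloidal

variable {ν T C : ℝ} {u : ℝ → EuclideanSpace ℝ (Fin 3) → EuclideanSpace ℝ (Fin 3)}
  {p : ℝ → EuclideanSpace ℝ (Fin 3) → ℝ}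

/-- Near `T⁻` the swirl of a witness is bounded by any bound `Mₛ` of the datum's swirl (swirl maximum principle for the
witness class: the tree's `abs_swirl_le_of_classical_Ico` with the sub-slab bounds `bounded_before_of_lerayHopf_classical`).
[cite: KochNadirashviliSereginSverak2009, (1.10)] -/
theorem eventually_abs_swirl_le_of_datum (hν : 0 < ν) (hT : 0 < T) (hmax : IsMaximalSmoothSolution ν 0 u p T)
    (hLH : IsLerayHopfOn T ν 0 (u 0) u) (hdec : HasRapidSpatialDecay (u 0)) (haxi : IsAxisymmetric (u 0)) {Mₛ : ℝ}
    (hMₛ : ∀ x, |swirl (u 0) x| ≤ Mₛ) : ∀ᶠ t in 𝓝[<] T, ∀ x, |swirl (u t) x| ≤ Mₛ := by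
  have hIco : ∀ᶠ t in 𝓝[<] T, t ∈ Ico 0 T := Ico_mem_nhdsLT hT
  have hcl := hmax.isClassicalNSSolutionOn
  exact hIco.mono fun t ht x => abs_swirl_le_of_classical_Ico hν hcl
    (isAxisymmetric_slice_of_lerayHopf_classical hν hcl hLH hdec haxi)
    (bounded_before_of_lerayHopf_classical hν hcl hLH hdec haxi) hMₛ t ht x

/-- **THE SWIRL VELOCITY OF A CERTIFICATE-CLASS WITNESS IS TYPE I**: if `(T − t)‖ω(t, x)‖ ≤ C_ω` for `t` near `T⁻` and
`|Γ₀| ≤ Mₛ`, then `(T − t)·u_θ(t, x)² ≤ ½ Mₛ C_ω` for `t` near `T⁻` and every `x` (`u_θ = swirlVelocity (u t)`; in space the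
swirl velocity is Type I automatically, `r|u_θ| = |Γ| ≤ Mₛ`). [cite: KochNadirashviliSereginSverak2009, (1.10)] -/
theorem vorticityRate_witness_sq_swirlVelocity_typeI (hν : 0 < ν) (hT : 0 < T) (hmax : IsMaximalSmoothSolution ν 0 u p T)
    (hLH : IsLerayHopfOn T ν 0 (u 0) u) (hdec : HasRapidSpatialDecay (u 0)) (haxi : IsAxisymmetric (u 0))
    (hrate : ∀ᶠ t in 𝓝[<] T, ∀ x, (T - t) * ‖curl (u t) x‖ ≤ C) {Mₛ : ℝ} (hMₛ : ∀ x, |swirl (u 0) x| ≤ Mₛ) :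
    ∀ᶠ t in 𝓝[<] T, ∀ x, (T - t) * swirlVelocity (u t) x ^ 2 ≤ Mₛ * C / 2 := by
  obtain ⟨hax, hu⟩ := eventually_isAxisymmetric_and_contDiff_slice hν hT hmax hLH hdec haxi
  exact eventually_sq_swirlVelocity_le_of_vorticityRate hax (hu.mono fun t ht => ht.differentiable two_ne_zero)
    (eventually_abs_swirl_le_of_datum hν hT hmax hLH hdec haxi hMₛ) hrate

/-- **THE BLOW-UP OF A CERTIFICATE-CLASS WITNESS IS POLOIDAL AND TYPE II**: for a witness `(ν, T, u, p)` with
`(T − t)‖ω(t)‖_∞ ≤ C_ω` near `T⁻`, NO constant `C'` gives `‖u_pol(t, x)‖ ≤ C'/√(T − t)` near `T⁻` (`u_pol = poloidalPart (u t)`):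
the witness is not of Type I (KNSS 2009 / Seregin–Šverák 2009, tree `knss_no_axisymmetric_typeI_holds` via
`not_isTypeIBlowup_of_isMaximalSmoothSolution`) while its swirl velocity is (`vorticityRate_witness_sq_swirlVelocity_typeI`),
so the Type-II excess sits in the poloidal components `(u_r, u_z)`. [cite: KochNadirashviliSereginSverak2009, Thms 6.1–6.2] -/
theorem vorticityRate_witness_not_poloidal_typeI (hν : 0 < ν) (hT : 0 < T) (hmax : IsMaximalSmoothSolution ν 0 u p T)
    (hLH : IsLerayHopfOn T ν 0 (u 0) u) (hdec : HasRapidSpatialDecay (u 0)) (haxi : IsAxisymmetric (u 0))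
    (hrate : ∀ᶠ t in 𝓝[<] T, ∀ x, (T - t) * ‖curl (u t) x‖ ≤ C) (C' : ℝ) :
    ¬ ∀ᶠ t in 𝓝[<] T, ∀ x, ‖poloidalPart (u t) x‖ ≤ C' / Real.sqrt (T - t) := by
  obtain ⟨Mₛ, hMₛ⟩ := hdec.abs_swirl_le
  obtain ⟨hax, hu⟩ := eventually_isAxisymmetric_and_contDiff_slice hν hT hmax hLH hdec haxi
  exact not_poloidal_typeI_of_not_isTypeIBlowup_of_vorticityRate hax (hu.mono fun t ht => ht.differentiable two_ne_zero)
    (eventually_abs_swirl_le_of_datum hν hT hmax hLH hdec haxi hMₛ) hrate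
    (not_isTypeIBlowup_of_isMaximalSmoothSolution hν hT hmax hLH hdec haxi) C'

end Poloidal

section InnerSwirlVelocity

variable {C Γs : ℝ} {W : ℝ → EuclideanSpace ℝ (Fin 3) → EuclideanSpace ℝ (Fin 3)}

/-- **The inner object's swirl VELOCITY dies uniformly into the past**: for a KNSS blow-up limit `W` with axisymmetric slices,
`|Γ_W| ≤ Γ*` and `‖curl W(s)‖_∞ ≤ C/|s|`, one has `|s|·W_θ(s, y)² ≤ ½ Γ* C` for all `s < 0`, `y` — i.e.
`‖W_θ(s, ·)‖_∞ ≤ √(Γ*C/(2|s|)) → 0` as `s → −∞`, uniformly in `y` (part XLI `sq_swirlVelocity_le_of_abs_swirl_le_of_norm_curl_le`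
at vorticity level `C/|s|`). [cite: MajdaBertozziCUP2002, §2.3.3 eq. (2.64) (integrated along horizontal rays)] -/
theorem innerObject_sq_swirlVelocity_le_of_curl_le (hW : IsKNSSBlowupLimit W) (hax : ∀ s < 0, IsAxisymmetric (W s))
    (hΓ : ∀ s < 0, ∀ y : EuclideanSpace ℝ (Fin 3), |swirl (W s) y| ≤ Γs)
    (hcurl : ∀ s < 0, ∀ y : EuclideanSpace ℝ (Fin 3), ‖curl (W s) y‖ ≤ C / |s|) {s : ℝ} (hs : s < 0)
    (y : EuclideanSpace ℝ (Fin 3)) : |s| * swirlVelocity (W s) y ^ 2 ≤ Γs * C / 2 := by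
  have hsm : ContDiff ℝ 2 (W s) :=
    contDiff_infty.1 (hW.smooth.comp_contDiff (contDiff_prodMk_right s) fun y => ⟨hs, mem_univ y⟩) 2
  have hs' : 0 < |s| := abs_pos.2 hs.ne
  have h := sq_swirlVelocity_le_of_abs_swirl_le_of_norm_curl_le (hax s hs) (hsm.differentiable two_ne_zero)
    (hΓ s hs) (hcurl s hs) y
  calc |s| * swirlVelocity (W s) y ^ 2 ≤ |s| * (Γs * (C / |s|) / 2) := mul_le_mul_of_nonneg_left h hs'.le
    _ = Γs * C / 2 := by field_simp

end InnerSwirlVelocity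

section AssembledPoloidal

variable {ν T : ℝ} {u : ℝ → EuclideanSpace ℝ (Fin 3) → EuclideanSpace ℝ (Fin 3)}
  {p : ℝ → EuclideanSpace ℝ (Fin 3) → ℝ}

/-- **CERTIFICATE-CLASS WITNESSES: SWIRL VELOCITY TYPE I, POLOIDAL TYPE II, AND THE INNER OBJECT'S SWIRL VELOCITY DIES INTO THE
PAST.** For every `(ν, T, u, p)` of the certificate class (maximal smooth, Leray–Hopf, rapidly decaying axisymmetric datum,
`(T − t)‖ω(t)‖_∞ ≤ C_ω` near `T⁻`), with `Mₛ` a bound of the datum's swirl: (i) `(T − t)u_θ² ≤ ½MₛC_ω` near `T⁻`; (ii) for no `C'`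
is `‖u_pol‖ ≤ C'/√(T − t)` near `T⁻` (the Type-II excess is poloidal); (iii) the zone-Z1 gauge data and inner object `W` with
`‖curl W(s)‖ ≤ C_ω/|s|`, and EITHER (α) `W ≡ c`, OR (β) `W` axisymmetric with `¬AxisymmetricLiouvilleBoundedSwirl`, `Γ_W ≢ 0`,
the past funnel `|s|·|Γ_W(s, y)| ≤ ½C_ω r(y)²`, AND `|s|·W_θ(s, y)² ≤ ½(Mₛ/ν)C_ω` — the inner object's swirl velocity tends to `0`
UNIFORMLY as `s → −∞`. [cite: KochNadirashviliSereginSverak2009, §6 (zoom bookkeeping)] -/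
theorem vorticityRate_witness_poloidal_alternative (hν : 0 < ν) (hT : 0 < T)
    (hmax : IsMaximalSmoothSolution ν 0 u p T) (hLH : IsLerayHopfOn T ν 0 (u 0) u)
    (hdec : HasRapidSpatialDecay (u 0)) (haxi : IsAxisymmetric (u 0))
    (hrate : ∃ C : ℝ, ∀ᶠ t in 𝓝[<] T, ∀ x : EuclideanSpace ℝ (Fin 3), (T - t) * ‖curl (u t) x‖ ≤ C) :
    ∃ (C Mₛ : ℝ) (tn lamn : ℕ → ℝ) (cn : ℕ → EuclideanSpace ℝ (Fin 3)) (φ : ℕ → ℕ)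
      (W : ℝ → EuclideanSpace ℝ (Fin 3) → EuclideanSpace ℝ (Fin 3)),
      (∀ x, |swirl (u 0) x| ≤ Mₛ) ∧
      (∀ᶠ t in 𝓝[<] T, ∀ x, (T - t) * swirlVelocity (u t) x ^ 2 ≤ Mₛ * C / 2) ∧
      (∀ C' : ℝ, ¬ ∀ᶠ t in 𝓝[<] T, ∀ x, ‖poloidalPart (u t) x‖ ≤ C' / Real.sqrt (T - t)) ∧
      (∀ k, T / 2 ≤ tn k ∧ tn k < T) ∧ Tendsto tn atTop (𝓝 T) ∧ (∀ k, 0 < lamn k) ∧ Tendsto lamn atTop (𝓝 0) ∧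
      (∀ k, ∀ t ∈ Icc 0 (tn k), ∀ x, lamn k / ν * ‖u t x‖ ≤ 1) ∧ StrictMono φ ∧ IsKNSSBlowupLimit W ∧
      (∀ s < 0, TendstoLocallyUniformly
        (fun k => ((lamn (φ k) / ν) • stPull (lamn (φ k) ^ 2 / ν) (lamn (φ k)) (tn (φ k)) (cn (φ k)) u) s)
          (W s) atTop) ∧
      (∀ s < 0, ∀ y : EuclideanSpace ℝ (Fin 3), ‖curl (W s) y‖ ≤ C / |s|) ∧
      ((∃ c : EuclideanSpace ℝ (Fin 3), ‖c‖ = 1 ∧ c 1 = 0 ∧ ∀ s < 0, ∀ y : EuclideanSpace ℝ (Fin 3), W s y = c) ∨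
        ((∀ s < 0, IsAxisymmetric (W s)) ∧
          ¬ Summit.NavierStokesRegularity.NavierStokesRegularity.AxisymmetricLiouvilleBoundedSwirl ∧
          (∃ s < 0, ∃ y : EuclideanSpace ℝ (Fin 3), swirl (W s) y ≠ 0) ∧
          (∀ s < 0, ∀ y : EuclideanSpace ℝ (Fin 3), |s| * |swirl (W s) y| ≤ C / 2 * cylRadius y ^ 2) ∧
          ∀ s < 0, ∀ y : EuclideanSpace ℝ (Fin 3), |s| * swirlVelocity (W s) y ^ 2 ≤ Mₛ / ν * C / 2)) := by
  obtain ⟨C, hC⟩ := hrate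
  obtain ⟨Mₛ, hMₛ⟩ := hdec.abs_swirl_le
  obtain ⟨tn, lamn, cn, xn, φ, W, htn, htT, hlam, hlam0, hgauge, -, -, -, -, -, -, hφ, hW, hconv, -, hcurl, halt⟩ :=
    innerObject_master_of_datum hν hT hmax hLH hdec haxi hMₛ
  have hcurlle : ∀ s < 0, ∀ y : EuclideanSpace ℝ (Fin 3), ‖curl (W s) y‖ ≤ C / |s| :=
    fun s hs y => vorticityRate_innerObject_curl_le hν htn htT hlam0 hφ hC hcurl hs y
  refine ⟨C, Mₛ, tn, lamn, cn, φ, W, hMₛ, vorticityRate_witness_sq_swirlVelocity_typeI hν hT hmax hLH hdec haxi hC hMₛ,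
    vorticityRate_witness_not_poloidal_typeI hν hT hmax hLH hdec haxi hC, htn, htT, hlam, hlam0, hgauge, hφ, hW, hconv,
    hcurlle, ?_⟩
  rcases halt with ⟨hc, -⟩ | ⟨-, hnot, haxW, hswb, -, -, hswirl, -, -, -, -, -⟩
  · exact Or.inl hc
  · refine Or.inr ⟨haxW, hnot, ?_, fun s hs y => (innerObject_swirl_funnel_of_curl_le hW haxW hcurlle hs y).1,
      fun s hs y => innerObject_sq_swirlVelocity_le_of_curl_le hW haxW hswb hcurlle hs y⟩
    obtain ⟨s, hs, y, hne, -⟩ := hswirl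
    exact ⟨s, hs, y, hne⟩

end AssembledPoloidal


/-! ### Appendix 2 (g10, third deposit): SWIRL IMPORT FROM INFINITY — the swirl maximum principle for the blow-up limit
(`IsKNSSBlowupLimit.abs_swirl_le_of_le`, KNSS 2009 (1.9)–(1.10)) turns the past funnel into a statement about WHERE the
inner object's swirl lives: a level seen at `s₀` is present at every earlier time, only at radii `r ≥ √(2m|s|/C_ω)`. -/

section SwirlImport

variable {C : ℝ} {W : ℝ → EuclideanSpace ℝ (Fin 3) → EuclideanSpace ℝ (Fin 3)}

/-- **Swirl import from infinity.** For a KNSS blow-up limit `W` with axisymmetric slices, `‖curl W(s)‖_∞ ≤ C/|s|`, `0 < C`: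
if `m < |Γ_W(s₀, y₀)|` (`s₀ < 0`) then at EVERY `s ≤ s₀` some `y` has `m < |Γ_W(s, y)|` and `2m|s|/C < r(y)²` — the level `m`
is carried at radii `≥ √(2m|s|/C)`, receding parabolically into the past (swirl maximum principle + past funnel).
[cite: KochNadirashviliSereginSverak2009, §1 (1.9)–(1.10)] -/
theorem innerObject_swirl_import (hW : IsKNSSBlowupLimit W) (hax : ∀ s < 0, IsAxisymmetric (W s))
    (hcurl : ∀ s < 0, ∀ y : EuclideanSpace ℝ (Fin 3), ‖curl (W s) y‖ ≤ C / |s|) (hC : 0 < C) {s₀ : ℝ} (hs₀ : s₀ < 0)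
    {y₀ : EuclideanSpace ℝ (Fin 3)} {m : ℝ} (hm : m < |swirl (W s₀) y₀|) {s : ℝ} (hs : s ≤ s₀) :
    ∃ y : EuclideanSpace ℝ (Fin 3), m < |swirl (W s) y| ∧ 2 * m * |s| / C < cylRadius y ^ 2 := by
  obtain ⟨y, hy⟩ := hW.exists_lt_abs_swirl_of_lt hax hs hs₀ hm
  exact ⟨y, hy, innerObject_cylRadius_sq_gt_of_lt_abs_swirl hW hax hcurl hC (lt_of_le_of_lt hs hs₀) hy⟩

end SwirlImport

section AssembledImport

variable {ν T : ℝ} {u : ℝ → EuclideanSpace ℝ (Fin 3) → EuclideanSpace ℝ (Fin 3)} {p : ℝ → EuclideanSpace ℝ (Fin 3) → ℝ}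

/-- **CERTIFICATE-CLASS WITNESSES, BRANCH (β): THE INNER OBJECT'S SWIRL IS IMPORTED FROM INFINITY.** For every witness of
the certificate class: Z1 gauge data and inner object `W` with `‖curl W(s)‖ ≤ C_ω/|s|`, and EITHER (α) `W ≡ c`, OR (β) `0 < C_ω`,
`W` axisymmetric with `¬AxisymmetricLiouvilleBoundedSwirl`, swirl sup NON-INCREASING in `s`, swirl velocity dying uniformly
(`|s|·W_θ² ≤ ½(Mₛ/ν)C_ω`), AND a level `g > 0` at some `s₀ < 0` such that for EVERY `s ≤ s₀` and `m < g` some `y` has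
`m < |Γ_W(s, y)|` and `2m|s|/C_ω < r(y)²` — the inner object's swirl lives at parabolically receding radii in the past and is
carried inward over time. [cite: KochNadirashviliSereginSverak2009, §6 (zoom bookkeeping)] -/
theorem vorticityRate_witness_swirlImport_alternative (hν : 0 < ν) (hT : 0 < T) (hmax : IsMaximalSmoothSolution ν 0 u p T)
    (hLH : IsLerayHopfOn T ν 0 (u 0) u) (hdec : HasRapidSpatialDecay (u 0)) (haxi : IsAxisymmetric (u 0))
    (hrate : ∃ C : ℝ, ∀ᶠ t in 𝓝[<] T, ∀ x : EuclideanSpace ℝ (Fin 3), (T - t) * ‖curl (u t) x‖ ≤ C) :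
    ∃ (C Mₛ : ℝ) (tn lamn : ℕ → ℝ) (cn : ℕ → EuclideanSpace ℝ (Fin 3)) (φ : ℕ → ℕ)
      (W : ℝ → EuclideanSpace ℝ (Fin 3) → EuclideanSpace ℝ (Fin 3)), (∀ x, |swirl (u 0) x| ≤ Mₛ) ∧
      (∀ k, T / 2 ≤ tn k ∧ tn k < T) ∧ Tendsto tn atTop (𝓝 T) ∧ (∀ k, 0 < lamn k) ∧ Tendsto lamn atTop (𝓝 0) ∧
      (∀ k, ∀ t ∈ Icc 0 (tn k), ∀ x, lamn k / ν * ‖u t x‖ ≤ 1) ∧ StrictMono φ ∧ IsKNSSBlowupLimit W ∧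
      (∀ s < 0, TendstoLocallyUniformly
        (fun k => ((lamn (φ k) / ν) • stPull (lamn (φ k) ^ 2 / ν) (lamn (φ k)) (tn (φ k)) (cn (φ k)) u) s)
          (W s) atTop) ∧
      (∀ s < 0, ∀ y : EuclideanSpace ℝ (Fin 3), ‖curl (W s) y‖ ≤ C / |s|) ∧
      ((∃ c : EuclideanSpace ℝ (Fin 3), ‖c‖ = 1 ∧ c 1 = 0 ∧ ∀ s < 0, ∀ y : EuclideanSpace ℝ (Fin 3), W s y = c) ∨
        (0 < C ∧ (∀ s < 0, IsAxisymmetric (W s)) ∧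
          ¬ Summit.NavierStokesRegularity.NavierStokesRegularity.AxisymmetricLiouvilleBoundedSwirl ∧
          (∀ s₁ s₂ M : ℝ, s₁ ≤ s₂ → s₂ < 0 → (∀ y : EuclideanSpace ℝ (Fin 3), |swirl (W s₁) y| ≤ M) →
            ∀ y : EuclideanSpace ℝ (Fin 3), |swirl (W s₂) y| ≤ M) ∧
          (∀ s < 0, ∀ y : EuclideanSpace ℝ (Fin 3), |s| * swirlVelocity (W s) y ^ 2 ≤ Mₛ / ν * C / 2) ∧
          ∃ s₀ < 0, ∃ g : ℝ, 0 < g ∧ ∀ s ≤ s₀, ∀ m < g, ∃ y : EuclideanSpace ℝ (Fin 3),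
            m < |swirl (W s) y| ∧ 2 * m * |s| / C < cylRadius y ^ 2)) := by
  obtain ⟨C, hC⟩ := hrate; obtain ⟨Mₛ, hMₛ⟩ := hdec.abs_swirl_le
  obtain ⟨tn, lamn, cn, xn, φ, W, htn, htT, hlam, hlam0, hgauge, -, -, -, -, -, -, hφ, hW, hconv, -, hcurl, halt⟩ :=
    innerObject_master_of_datum hν hT hmax hLH hdec haxi hMₛ
  have hcurlle : ∀ s < 0, ∀ y : EuclideanSpace ℝ (Fin 3), ‖curl (W s) y‖ ≤ C / |s| :=
    fun s hs y => vorticityRate_innerObject_curl_le hν htn htT hlam0 hφ hC hcurl hs y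
  refine ⟨C, Mₛ, tn, lamn, cn, φ, W, hMₛ, htn, htT, hlam, hlam0, hgauge, hφ, hW, hconv, hcurlle, ?_⟩
  rcases halt with ⟨hc, -⟩ | ⟨-, hnot, haxW, hswb, -, hcurlne, hswirl, -, -, -, -, -⟩
  · exact Or.inl hc
  · obtain ⟨s₁, hs₁, y₁, hne⟩ := hcurlne; obtain ⟨s₀, hs₀, y₀, hne₀, -⟩ := hswirl
    have hCpos : 0 < C := by
      by_contra hC0; have h1 := hcurlle s₁ hs₁ y₁
      linarith [norm_pos_iff.2 hne, div_nonpos_of_nonpos_of_nonneg (not_lt.1 hC0) (abs_nonneg s₁)]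
    refine Or.inr ⟨hCpos, haxW, hnot, fun s₁ s₂ M h12 hs₂ hM y => hW.abs_swirl_le_of_le haxW h12 hs₂ hM y,
      fun s hs y => innerObject_sq_swirlVelocity_le_of_curl_le hW haxW hswb hcurlle hs y,
      s₀, hs₀, |swirl (W s₀) y₀|, abs_pos.2 hne₀, fun s hs m hm => ?_⟩
    exact innerObject_swirl_import hW haxW hcurlle hCpos hs₀ hm hs

end AssembledImport

end Summit.NavierStokesRegularity.NavierStokesRegularity.Theorems.CertifiedBlowupVorticityRateBlowup.InnerObject
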